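import Literature.Barriers.MatrixMultiplication.IrreversibilityBarrier
import Literature.Computability.AlgebraicComplexity.RelativeExponentProofs
import HarnessLib

/-!
# `i_M(t) ≥ i(t)` — proof of `CVZ2021_prop7` (Christandl–Vrana–Zuiddam 2021, Prop. 7)

Topic `Literature/Barriers/MatrixMultiplication`; DISCHARGE of the named fact `CVZ2021_prop7` of
the catalogue entry `IrreversibilityBarrier.lean` (M. Christandl, P. Vrana, J. Zuiddam, *Barriers
for fast matrix multiplication from irreversibility*, Theory of Computing 17 (2021), art. 2 =
arXiv:1812.06952; **arXiv v1/v2 numbering**, Prop. 7 on p. 6, page-checked with `lit read`: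
"Let `s, t, u` be tensors. • `ω_M(t,t) = 1` • `ω_M(s,t) ω_M(t,u) ≥ ω_M(s,u)` • `ω_M(s,t) ≥ ω(s,t)`
• `i_M(t) ≥ i(t)`."). The fact stays a `def`; its users `(h : CVZ2021_prop7)` are fed
`CVZ2021_prop7_holds`. (The sibling `IrreversibilityBarrierProofs.lean` discharges
`CVZ2021_relativeExponent_unit`, §2.2; this file is independent of it.)

## Content

* `CVZ2021_prop7_holds : CVZ2021_prop7` — CVZ Prop. 7, fourth item, `i_M(t) ≥ i(t)` (as vendored:
  Assumption 1 and the finiteness hypothesis `∃ m, t^{⊗m} ≥_M ⟨2⟩`; the proof uses only the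
  latter), from `irreversibility_le_monIrreversibility`
  (`Literature/Computability/AlgebraicComplexity/RelativeExponentProofs.lean`).

## Proof

CVZ print no proof ("replacing the preorder `≥` by `≥_M` …", §2.4; the third item `ω_M ≥ ω` is "a
monomial restriction is a restriction"). In the tree's infimum formalisation
`ω(t,s) = ⨅ₙ n⁻¹ min {m | t^{⊗m} ≥ s^{⊗n}}`, `ω_M` likewise with `≥_M`: monomial restrictions
compose and pass to tensor powers (`TensorMonRestrictsTo.trans`, `TensorMonRestrictsTo.kroneckerPow`,
`tensorMonRestrictsTo_kroneckerPow_mul`), so the single witness `t^{⊗m} ≥_M ⟨2⟩` yields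
`t^{⊗(n m)} ≥_M (t^{⊗m})^{⊗n} ≥_M ⟨2⟩^{⊗n}` for every `n`; hence every set
`{m' | t^{⊗m'} ≥_M ⟨2⟩^{⊗n}}` is nonempty, `min {m' | t^{⊗m'} ≥ ⟨2⟩^{⊗n}} ≤ min {m' | t^{⊗m'} ≥_M ⟨2⟩^{⊗n}}`
termwise, `ω(t,⟨2⟩) ≤ ω_M(t,⟨2⟩)`, and
`i(t) = ω(⟨2⟩,t) ω(t,⟨2⟩) ≤ ω(⟨2⟩,t) ω_M(t,⟨2⟩) = i_M(t)` since `ω(⟨2⟩,t) ≥ 0`.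

## References

* M. Christandl, P. Vrana, J. Zuiddam, ToC 17 (2021), art. 2 = arXiv:1812.06952, §2.4 and Prop. 7
  (p. 6). [ChristandlVranaZuiddam2021]
-/

noncomputable section

namespace Literature.Barriers.MatrixMultiplication

/-- **CVZ 2021, Proposition 7 (fourth item), proved**: `i(t) ≤ i_M(t)` for every 3-tensor `t` over
a field some power of which restricts monomially to `⟨2⟩` — the named fact `CVZ2021_prop7` holds
(its Assumption-1 hypothesis is not even used). From `irreversibility_le_monIrreversibility`
(`RelativeExponentProofs.lean`), see the module docstring for the argument.
[cite: ChristandlVranaZuiddam2021, Prop. 7] -/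
theorem CVZ2021_prop7_holds : CVZ2021_prop7 := by
  intro K _ ι κ μ _ _ _ t _ hQ
  exact Literature.Computability.AlgebraicComplexity.irreversibility_le_monIrreversibility hQ

end Literature.Barriers.MatrixMultiplication

end
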